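import Summits.AtomisticToContinuum.Crystallization.Theorems.ChargedEnergyGapBrickUpper
import HarnessLib

/-!
# Charged energy gap — lens-3 g64, node «BarlowRef» (R3) — part 13 (addendum; imports part 12 `…BrickUpper`, to be landed after it): ROTATED BOXES AND CYLINDERS, isometry-invariance of volume, and the IMAGE-COORDINATE brick upper count

The certified numerator of `TubeShareBoundH` (HANDOFF g65 item 2) counts sites of a Barlow image `g '' barlowStacking a h s` in containers that
live in IMAGE coordinates (where the source `y`, the member `c` and the targets `z` live): cored balls, half-spaces, and — in the tube regime —
CYLINDERS about the axis `(y, c)` (part 10: `norm_perp_le_shadowRadius`, `axial_range`).  This part supplies, with Mathlib's measure theory only: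

* `volume_preimage_isometry` — an isometry `g` of `E3` preserves Lebesgue measure of EVERY set (`g` is an affine isometry equivalence:
  `Isometry.affineIsometryOfStrictConvexSpace` + `AffineIsometry.toAffineIsometryEquiv`; linear part `LinearIsometryEquiv.measurePreserving`,
  translation `measurePreserving_add_right`; `MeasurableEquiv.map_apply` for arbitrary sets);
* ★★ `card_mul_le_volume_near_of_subset_image` — for window data `(a,h)`, an isometry `g`, ANY set `K ⊆ E3` and finite
  `T ⊆ g '' barlowStacking a h s ∩ K`: `#T · a(a√3/2)h ≤ volume {x | ∃ z ∈ K, dist x z ≤ 9/5}` (the bricks of the pulled-back sites lie in the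
  preimage of the `9/5`-neighbourhood of `K`; part 12's `card_mul_le_volume` does the counting);
* `volume_orthoBox` — a box in the coordinates of ANY orthonormal basis `b` of `E3`, cornered anywhere: `volume {x | ∀ m, lo m ≤ ⟪b m, x − c⟫ ≤ hi m}
  = ∏ (hi m − lo m)` (`OrthonormalBasis.measurePreserving_repr` + translation + part 5's `volume_coordBox'`);
* `volume_coordCylinder`, ★ `volume_orthoCylinder` — the solid cylinder `{α ≤ ⟪b 2, x − c⟫ ≤ β, ⟪b 0, x − c⟫² + ⟪b 1, x − c⟫² ≤ σ²}` has volume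
  `(β − α) · π σ²` (`MeasurableEquiv.piFinSuccAbove` Fubini + `EuclideanSpace.volume_closedBall_fin_two`);
* the bridge to part 10's perpendicular: `exists_orthonormalBasis_axis` (an orthonormal basis with `b 2 = (dist y c)⁻¹ • (c − y)`),
  `inner_sq_add_inner_sq_eq` (Parseval: `⟪b 0,v⟫² + ⟪b 1,v⟫² = ‖v‖² − ⟪b 2,v⟫²`), ★ `radial_sq_le_of_norm_perp_le` (part 10's
  `‖(z − y) − (⟪z − y, c − y⟫/dist y c²)•(c − y)‖ ≤ σ` ⟹ `⟪b 0, z − y⟫² + ⟪b 1, z − y⟫² ≤ σ²`), `inner_axis_eq` (`⟪b 2, z − y⟫ = ⟪z − y, c − y⟫/dist y c`);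
* `near_orthoCylinder_subset` (the `D`-neighbourhood of a cylinder lies in the cylinder with `α − D, β + D, σ + D`) and the record shape
  ★★ `card_mul_le_cylinder_of_subset_image`: `T ⊆ g '' stacking ∩ cylinder(α, β, σ)` ⟹ `#T · V(a,h) ≤ (β − α + 18/5) · π (σ + 9/5)²`.

0 sorry; standard axioms.
-/

noncomputable section

open scoped Classical RealInnerProductSpace ENNReal
open MeasureTheory
open Literature.MathematicalPhysics.StatisticalMechanics Literature.Geometry.DiscreteGeometry
open Summit.AtomisticToContinuum.Crystallization.Theses.PricedLinkCensus
open Summit.AtomisticToContinuum.Crystallization.Theorems.ChargedEnergyGapNegative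

namespace Summit.AtomisticToContinuum.Crystallization.Theorems.ChargedEnergyGapChartDial

section OrthoVolume

/-! ## §1 Isometries of `E3` preserve volume; the image-coordinate brick upper count -/

/-- An isometry of `E3` preserves the Lebesgue measure of EVERY set (it is an affine isometry equivalence). -/
theorem volume_preimage_isometry {g : E3 → E3} (hg : Isometry g) (A : Set E3) : volume (g ⁻¹' A) = volume A := by
  let F := hg.affineIsometryOfStrictConvexSpace.toAffineIsometryEquiv rfl
  have hF : ⇑F = g := rfl
  have hdec : (⇑F : E3 → E3) = (fun x => x + F 0) ∘ (F.linearIsometryEquiv : E3 → E3) := by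
    funext x
    simp only [Function.comp_apply]
    have := F.map_vadd 0 x
    simp only [vadd_eq_add, add_zero] at this
    rw [this]
  have hmp : MeasurePreserving (⇑F : E3 → E3) volume volume := by
    rw [hdec]
    exact (measurePreserving_add_right volume (F 0)).comp F.linearIsometryEquiv.measurePreserving
  have hme : MeasurePreserving (⇑F.toHomeomorph.toMeasurableEquiv) volume volume := hmp
  rw [← hF]
  change volume (⇑F.toHomeomorph.toMeasurableEquiv ⁻¹' A) = volume A
  rw [← MeasurableEquiv.map_apply, hme.map_eq]

/-- ★★ THE IMAGE-COORDINATE BRICK UPPER COUNT: window data `(a, h)`, `g` an isometry, ANY set `K`, finite `T ⊆ g '' barlowStacking a h s ∩ K` ⟹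
`#T · a(a√3/2)h ≤ volume {x | ∃ z ∈ K, dist x z ≤ 9/5}` — the container is bounded in IMAGE coordinates; nothing is pulled back by hand. -/
theorem card_mul_le_volume_near_of_subset_image {a h : ℝ} {s : ℤ → ℤ} {g : E3 → E3}
    (ha : 9 / 10 ≤ a ∧ a ≤ 11 / 10) (hh : 0 < h ∧ 27 / 50 * a ^ 2 ≤ h ^ 2 ∧ h ^ 2 ≤ 121 / 150 * a ^ 2) (hg : Isometry g)
    (K : Set E3) (T : Finset E3) (hT : ↑T ⊆ g '' barlowStacking a h s ∩ K) :
    (T.card : ℝ≥0∞) * ENNReal.ofReal (a * (a * √3 / 2) * h) ≤ volume {x : E3 | ∃ z ∈ K, dist x z ≤ 9 / 5} := by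
  have ha0 : 0 < a := by linarith [ha.1]
  have hidx : ∀ p ∈ T, ∃ t : ℤ × ℤ × ℤ, g (barlowPos a h s t.1 t.2.1 t.2.2) = p ∧ g (barlowPos a h s t.1 t.2.1 t.2.2) ∈ K := by
    intro p hp
    obtain ⟨⟨y, hy, rfl⟩, hK⟩ := hT (Finset.mem_coe.2 hp)
    obtain ⟨k, i, j, rfl⟩ := hy
    exact ⟨(k, i, j), rfl, hK⟩
  choose! idx hidx1 hidx2 using hidx
  have hinj : Set.InjOn idx ↑T := by
    intro p hp p' hp' he
    rw [← hidx1 p (Finset.mem_coe.1 hp), ← hidx1 p' (Finset.mem_coe.1 hp'), he]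
  have hcard : (T.image idx).card = T.card := Finset.card_image_of_injOn hinj
  rw [← hcard, ← volume_preimage_isometry hg]
  refine card_mul_le_volume a h s ha0 hh.1 (T.image idx) _ fun t ht x hx => ?_
  obtain ⟨p, hp, rfl⟩ := Finset.mem_image.1 ht
  refine ⟨g (barlowPos a h s (idx p).1 (idx p).2.1 (idx p).2.2), hidx2 p hp, ?_⟩
  rw [hg.dist_eq]
  exact dist_le_of_mem_brick a h s (by norm_num) (window_brick_diag ha hh) hx

/-! ## §2 Boxes and cylinders in the coordinates of an orthonormal basis -/

/-- VOLUME OF A ROTATED BOX: for any orthonormal basis `b` of `E3` and any corner `c`, `volume {x | ∀ m, lo m ≤ ⟪b m, x − c⟫ ≤ hi m} = ∏ (hi m − lo m)`. -/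
theorem volume_orthoBox (b : OrthonormalBasis (Fin 3) ℝ E3) (c : E3) (lo hi : Fin 3 → ℝ) :
    volume {x : E3 | ∀ m, lo m ≤ ⟪b m, x - c⟫ ∧ ⟪b m, x - c⟫ ≤ hi m} = ∏ m, ENNReal.ofReal (hi m - lo m) := by
  have hT : MeasurePreserving (fun x : E3 => b.repr (x - c)) volume volume :=
    b.measurePreserving_repr.comp (measurePreserving_sub_right volume c)
  have hset : {x : E3 | ∀ m, lo m ≤ ⟪b m, x - c⟫ ∧ ⟪b m, x - c⟫ ≤ hi m} =
      (fun x : E3 => b.repr (x - c)) ⁻¹' {q : E3 | WithLp.ofLp q ∈ Set.Icc lo hi} := by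
    ext x
    simp only [Set.mem_setOf_eq, Set.mem_preimage, Set.mem_Icc, Pi.le_def, ← forall_and]
    refine forall_congr' fun m => ?_
    rw [show WithLp.ofLp (b.repr (x - c)) m = ⟪b m, x - c⟫ from b.repr_apply_apply (x - c) m]
  have hmeas : MeasurableSet {q : E3 | WithLp.ofLp q ∈ Set.Icc lo hi} :=
    measurableSet_Icc.preimage (PiLp.volume_preserving_ofLp (Fin 3)).measurable
  rw [hset, hT.measure_preimage hmeas.nullMeasurableSet, volume_coordBox']

/-- VOLUME OF A COORDINATE CYLINDER: `volume {q : E3 | α ≤ q 2 ≤ β, q 0² + q 1² ≤ σ²} = (β − α) · (π σ²)` (`σ ≥ 0`). -/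
theorem volume_coordCylinder {α β σ : ℝ} (hσ : 0 ≤ σ) :
    volume {q : E3 | α ≤ q 2 ∧ q 2 ≤ β ∧ q 0 ^ 2 + q 1 ^ 2 ≤ σ ^ 2} =
      ENNReal.ofReal (β - α) * (ENNReal.ofReal σ ^ 2 * ENNReal.ofReal Real.pi) := by
  -- the disc in `Fin 2 → ℝ` and its volume
  set D : Set (Fin 2 → ℝ) := {p | p 0 ^ 2 + p 1 ^ 2 ≤ σ ^ 2} with hD
  have hDm : MeasurableSet D :=
    measurableSet_le (((measurable_pi_apply 0).pow_const 2).add ((measurable_pi_apply 1).pow_const 2)) measurable_const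
  have hDvol : volume D = ENNReal.ofReal σ ^ 2 * ENNReal.ofReal Real.pi := by
    have hpre : (WithLp.ofLp : EuclideanSpace ℝ (Fin 2) → (Fin 2 → ℝ)) ⁻¹' D = Metric.closedBall (0 : EuclideanSpace ℝ (Fin 2)) σ := by
      ext q
      simp only [Set.mem_preimage, hD, Set.mem_setOf_eq, Metric.mem_closedBall, dist_zero_right]
      rw [EuclideanSpace.norm_eq, Fin.sum_univ_two, Real.sqrt_le_left hσ]
      simp only [Real.norm_eq_abs, sq_abs]
    rw [← (PiLp.volume_preserving_ofLp (Fin 2)).measure_preimage hDm.nullMeasurableSet, hpre,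
      EuclideanSpace.volume_closedBall_fin_two]
  -- the set in `Fin 3 → ℝ` and the Fubini split at coordinate `2`
  set S' : Set (Fin 3 → ℝ) := {f | α ≤ f 2 ∧ f 2 ≤ β ∧ f 0 ^ 2 + f 1 ^ 2 ≤ σ ^ 2} with hS'
  have hsplit : S' = (MeasurableEquiv.piFinSuccAbove (fun _ => ℝ) 2) ⁻¹' (Set.Icc α β ×ˢ D) := by
    ext f
    simp only [hS', hD, Set.mem_setOf_eq, Set.mem_preimage, Set.mem_prod, Set.mem_Icc]
    have e0 : (2 : Fin 3).succAbove 0 = 0 := by decide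
    have e1 : (2 : Fin 3).succAbove 1 = 1 := by decide
    show _ ↔ (α ≤ f 2 ∧ f 2 ≤ β) ∧ f ((2 : Fin 3).succAbove 0) ^ 2 + f ((2 : Fin 3).succAbove 1) ^ 2 ≤ σ ^ 2
    rw [e0, e1, and_assoc]
  have hprodm : MeasurableSet (Set.Icc α β ×ˢ D) := measurableSet_Icc.prod hDm
  have hS'vol : volume S' = ENNReal.ofReal (β - α) * (ENNReal.ofReal σ ^ 2 * ENNReal.ofReal Real.pi) := by
    rw [hsplit, (volume_preserving_piFinSuccAbove (fun _ : Fin 3 => ℝ) 2).measure_preimage hprodm.nullMeasurableSet,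
      show (volume : Measure (ℝ × (Fin 2 → ℝ))) = (volume : Measure ℝ).prod volume from rfl,
      Measure.prod_prod, Real.volume_Icc, hDvol]
  -- transport to `E3`
  have hS'm : MeasurableSet S' := by rw [hsplit]; exact hprodm.preimage (MeasurableEquiv.measurable _)
  have hset : {q : E3 | α ≤ q 2 ∧ q 2 ≤ β ∧ q 0 ^ 2 + q 1 ^ 2 ≤ σ ^ 2} = (WithLp.ofLp : E3 → (Fin 3 → ℝ)) ⁻¹' S' := by
    ext q; simp only [hS', Set.mem_setOf_eq, Set.mem_preimage]
  rw [hset, (PiLp.volume_preserving_ofLp (Fin 3)).measure_preimage hS'm.nullMeasurableSet, hS'vol]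

/-- The solid cylinder in the coordinates of an orthonormal basis `b` about the corner `c`: axial coordinate `⟪b 2, x − c⟫ ∈ [α, β]`,
radial part `⟪b 0, x − c⟫² + ⟪b 1, x − c⟫² ≤ σ²`. -/
def orthoCylinder (b : OrthonormalBasis (Fin 3) ℝ E3) (c : E3) (α β σ : ℝ) : Set E3 :=
  {x | α ≤ ⟪b 2, x - c⟫ ∧ ⟪b 2, x - c⟫ ≤ β ∧ ⟪b 0, x - c⟫ ^ 2 + ⟪b 1, x - c⟫ ^ 2 ≤ σ ^ 2}

/-- ★ VOLUME OF A ROTATED CYLINDER: `volume (orthoCylinder b c α β σ) = (β − α) · π σ²` (`σ ≥ 0`; `ofReal (β − α) = 0` if `β < α`). -/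
theorem volume_orthoCylinder (b : OrthonormalBasis (Fin 3) ℝ E3) (c : E3) {α β σ : ℝ} (hσ : 0 ≤ σ) :
    volume (orthoCylinder b c α β σ) = ENNReal.ofReal (β - α) * (ENNReal.ofReal σ ^ 2 * ENNReal.ofReal Real.pi) := by
  have hT : MeasurePreserving (fun x : E3 => b.repr (x - c)) volume volume :=
    b.measurePreserving_repr.comp (measurePreserving_sub_right volume c)
  have hset : orthoCylinder b c α β σ =
      (fun x : E3 => b.repr (x - c)) ⁻¹' {q : E3 | α ≤ q 2 ∧ q 2 ≤ β ∧ q 0 ^ 2 + q 1 ^ 2 ≤ σ ^ 2} := by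
    ext x
    simp only [orthoCylinder, Set.mem_setOf_eq, Set.mem_preimage, b.repr_apply_apply]
  have hmeas : MeasurableSet {q : E3 | α ≤ q 2 ∧ q 2 ≤ β ∧ q 0 ^ 2 + q 1 ^ 2 ≤ σ ^ 2} := by
    have hm : ∀ m : Fin 3, Measurable fun q : E3 => q m := fun m => (measurable_pi_apply m).comp (PiLp.volume_preserving_ofLp (Fin 3)).measurable
    have hS : {q : E3 | α ≤ q 2 ∧ q 2 ≤ β ∧ q 0 ^ 2 + q 1 ^ 2 ≤ σ ^ 2} =
        ({q : E3 | α ≤ q 2} ∩ {q : E3 | q 2 ≤ β}) ∩ {q : E3 | q 0 ^ 2 + q 1 ^ 2 ≤ σ ^ 2} := by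
      ext q; simp only [Set.mem_setOf_eq, Set.mem_inter_iff, and_assoc]
    rw [hS]
    exact ((measurableSet_le measurable_const (hm 2)).inter (measurableSet_le (hm 2) measurable_const)).inter
      (measurableSet_le (show Measurable (fun q : E3 => q 0 ^ 2 + q 1 ^ 2) from ((hm 0).pow_const 2).add ((hm 1).pow_const 2))
        measurable_const)
  rw [hset, hT.measure_preimage hmeas.nullMeasurableSet, volume_coordCylinder hσ]

/-! ## §3 The bridge to part 10's axis and perpendicular -/

/-- There is an orthonormal basis of `E3` whose third vector is the unit axis from `y` to `c`. -/
theorem exists_orthonormalBasis_axis {y c : E3} (hyc : y ≠ c) : ∃ b : OrthonormalBasis (Fin 3) ℝ E3, b 2 = (dist y c)⁻¹ • (c - y) := by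
  have hd : 0 < dist y c := dist_pos.2 hyc
  set u : E3 := (dist y c)⁻¹ • (c - y) with hu
  have hun : ‖u‖ = 1 := by
    rw [hu, norm_smul, Real.norm_eq_abs, abs_of_pos (inv_pos.2 hd), ← dist_eq_norm', inv_mul_cancel₀ hd.ne']
  have hon : Orthonormal ℝ (({2} : Set (Fin 3)).restrict fun _ : Fin 3 => u) := by
    refine ⟨fun i => by simpa using hun, fun i j hij => ?_⟩
    exfalso; apply hij
    have hi := i.2; have hj := j.2
    simp only [Set.mem_singleton_iff] at hi hj
    exact Subtype.ext (hi.trans hj.symm)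
  obtain ⟨b, hb⟩ := Orthonormal.exists_orthonormalBasis_extension_of_card_eq (𝕜 := ℝ) (E := E3) (by simp) hon
  exact ⟨b, hb 2 rfl⟩

/-- Parseval in `E3`: `⟪b 0, v⟫² + ⟪b 1, v⟫² = ‖v‖² − ⟪b 2, v⟫²`. -/
theorem inner_sq_add_inner_sq_eq (b : OrthonormalBasis (Fin 3) ℝ E3) (v : E3) :
    ⟪b 0, v⟫ ^ 2 + ⟪b 1, v⟫ ^ 2 = ‖v‖ ^ 2 - ⟪b 2, v⟫ ^ 2 := by
  have := b.sum_sq_inner_right v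
  rw [Fin.sum_univ_three] at this
  linarith

/-- The radial part never exceeds the norm: `⟪b 0, v⟫² + ⟪b 1, v⟫² ≤ ‖v‖²`. -/
theorem radial_sq_le_norm_sq (b : OrthonormalBasis (Fin 3) ℝ E3) (v : E3) : ⟪b 0, v⟫ ^ 2 + ⟪b 1, v⟫ ^ 2 ≤ ‖v‖ ^ 2 := by
  rw [inner_sq_add_inner_sq_eq]; nlinarith [sq_nonneg ⟪b 2, v⟫]

/-- With the axis `b 2 = (dist y c)⁻¹ • (c − y)`: the axial coordinate of `z − y` is `⟪z − y, c − y⟫ / dist y c`. -/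
theorem inner_axis_eq {b : OrthonormalBasis (Fin 3) ℝ E3} {y c : E3} (hb : b 2 = (dist y c)⁻¹ • (c - y)) (v : E3) :
    ⟪b 2, v⟫ = ⟪v, c - y⟫ / dist y c := by
  rw [hb, real_inner_smul_left, real_inner_comm, div_eq_inv_mul]

/-- ★ With the axis `b 2 = (dist y c)⁻¹ • (c − y)` (`y ≠ c`): part 10's perpendicular bound `‖(z − y) − (⟪z − y, c − y⟫/dist y c²)•(c − y)‖ ≤ σ`
gives the radial bound `⟪b 0, z − y⟫² + ⟪b 1, z − y⟫² ≤ σ²`. -/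
theorem radial_sq_le_of_norm_perp_le {b : OrthonormalBasis (Fin 3) ℝ E3} {y c z : E3} {σ : ℝ} (hyc : y ≠ c)
    (hb : b 2 = (dist y c)⁻¹ • (c - y)) (hperp : ‖(z - y) - (⟪z - y, c - y⟫ / dist y c ^ 2) • (c - y)‖ ≤ σ) :
    ⟪b 0, z - y⟫ ^ 2 + ⟪b 1, z - y⟫ ^ 2 ≤ σ ^ 2 := by
  have hd : 0 < dist y c := dist_pos.2 hyc
  have hσ : 0 ≤ σ := (norm_nonneg _).trans hperp
  set v : E3 := z - y
  set w : E3 := c - y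
  have hw : ‖w‖ = dist y c := by rw [dist_eq_norm']
  have hax : ⟪b 2, v⟫ = ⟪v, w⟫ / dist y c := inner_axis_eq hb v
  -- ‖perp‖² = ‖v‖² − ⟪v,w⟫²/d²
  have hps : ‖v - (⟪v, w⟫ / dist y c ^ 2) • w‖ ^ 2 = ‖v‖ ^ 2 - ⟪v, w⟫ ^ 2 / dist y c ^ 2 := by
    rw [norm_sub_sq_real, real_inner_smul_right, norm_smul, Real.norm_eq_abs, mul_pow, sq_abs, hw]
    field_simp
    ring
  rw [inner_sq_add_inner_sq_eq, hax, div_pow, ← hps]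
  exact pow_le_pow_left₀ (norm_nonneg _) hperp 2

/-- MEMBERSHIP: a point `z` whose axial coordinate lies in `[α, β]` and whose radial part is `≤ σ²` lies in the cylinder (definitional). -/
theorem mem_orthoCylinder_iff (b : OrthonormalBasis (Fin 3) ℝ E3) (c : E3) (α β σ : ℝ) (x : E3) :
    x ∈ orthoCylinder b c α β σ ↔ α ≤ ⟪b 2, x - c⟫ ∧ ⟪b 2, x - c⟫ ≤ β ∧ ⟪b 0, x - c⟫ ^ 2 + ⟪b 1, x - c⟫ ^ 2 ≤ σ ^ 2 := Iff.rfl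

/-! ## §4 Neighbourhoods of cylinders and the record count -/

/-- The radial seminorm is subadditive: `√(⟪b 0,v+v'⟫² + ⟪b 1,v+v'⟫²) ≤ √(⟪b 0,v⟫² + ⟪b 1,v⟫²) + ‖v'‖`. [Cauchy–Schwarz in the plane + Parseval] -/
theorem radial_add_le (b : OrthonormalBasis (Fin 3) ℝ E3) (v v' : E3) :
    Real.sqrt (⟪b 0, v + v'⟫ ^ 2 + ⟪b 1, v + v'⟫ ^ 2) ≤ Real.sqrt (⟪b 0, v⟫ ^ 2 + ⟪b 1, v⟫ ^ 2) + ‖v'‖ := by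
  have h1 : Real.sqrt (⟪b 0, v + v'⟫ ^ 2 + ⟪b 1, v + v'⟫ ^ 2) ≤
      Real.sqrt (⟪b 0, v⟫ ^ 2 + ⟪b 1, v⟫ ^ 2) + Real.sqrt (⟪b 0, v'⟫ ^ 2 + ⟪b 1, v'⟫ ^ 2) := by
    rw [inner_add_right, inner_add_right]
    -- Minkowski in ℝ²
    set p : ℝ := ⟪b 0, v⟫; set q : ℝ := ⟪b 1, v⟫; set p' : ℝ := ⟪b 0, v'⟫; set q' : ℝ := ⟪b 1, v'⟫
    have hA := Real.sqrt_nonneg (p ^ 2 + q ^ 2)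
    have hB := Real.sqrt_nonneg (p' ^ 2 + q' ^ 2)
    have hA2 := Real.sq_sqrt (by positivity : 0 ≤ p ^ 2 + q ^ 2)
    have hB2 := Real.sq_sqrt (by positivity : 0 ≤ p' ^ 2 + q' ^ 2)
    rw [Real.sqrt_le_left (by positivity)]
    -- (p+p')² + (q+q')² ≤ (A + B)² since p p' + q q' ≤ A B (Cauchy–Schwarz)
    have hCS : p * p' + q * q' ≤ Real.sqrt (p ^ 2 + q ^ 2) * Real.sqrt (p' ^ 2 + q' ^ 2) := by
      have hprod : 0 ≤ Real.sqrt (p ^ 2 + q ^ 2) * Real.sqrt (p' ^ 2 + q' ^ 2) := mul_nonneg hA hB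
      by_cases hle : p * p' + q * q' ≤ 0
      · exact hle.trans hprod
      · rw [not_le] at hle
        have hsq : (p * p' + q * q') ^ 2 ≤ (Real.sqrt (p ^ 2 + q ^ 2) * Real.sqrt (p' ^ 2 + q' ^ 2)) ^ 2 := by
          rw [mul_pow, hA2, hB2]; nlinarith [sq_nonneg (p * q' - q * p')]
        exact (pow_le_pow_iff_left₀ hle.le hprod two_ne_zero).1 hsq
    nlinarith [hCS, hA2, hB2, hA, hB]
  calc Real.sqrt (⟪b 0, v + v'⟫ ^ 2 + ⟪b 1, v + v'⟫ ^ 2)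
      ≤ Real.sqrt (⟪b 0, v⟫ ^ 2 + ⟪b 1, v⟫ ^ 2) + Real.sqrt (⟪b 0, v'⟫ ^ 2 + ⟪b 1, v'⟫ ^ 2) := h1
    _ ≤ Real.sqrt (⟪b 0, v⟫ ^ 2 + ⟪b 1, v⟫ ^ 2) + ‖v'‖ := by
        gcongr
        rw [Real.sqrt_le_left (norm_nonneg _)]
        exact radial_sq_le_norm_sq b v'

/-- The `D`-neighbourhood of a cylinder lies in the cylinder enlarged by `D` in every direction (`σ, D ≥ 0`). -/
theorem near_orthoCylinder_subset (b : OrthonormalBasis (Fin 3) ℝ E3) (c : E3) (α β σ D : ℝ) (hσ : 0 ≤ σ) (hD : 0 ≤ D) :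
    {x : E3 | ∃ z ∈ orthoCylinder b c α β σ, dist x z ≤ D} ⊆ orthoCylinder b c (α - D) (β + D) (σ + D) := by
  rintro x ⟨z, hz, hxz⟩
  rw [mem_orthoCylinder_iff] at hz ⊢
  obtain ⟨h1, h2, h3⟩ := hz
  have hsplit : x - c = (z - c) + (x - z) := by abel
  have hn2 : ‖b 2‖ = 1 := b.orthonormal.1 2
  have hax : |⟪b 2, x - z⟫| ≤ D := by
    calc |⟪b 2, x - z⟫| ≤ ‖b 2‖ * ‖x - z‖ := abs_real_inner_le_norm _ _
      _ = dist x z := by rw [hn2, one_mul, dist_eq_norm]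
      _ ≤ D := hxz
  have hax' := abs_le.1 hax
  have hrad : Real.sqrt (⟪b 0, x - c⟫ ^ 2 + ⟪b 1, x - c⟫ ^ 2) ≤ σ + D := by
    rw [hsplit]
    calc Real.sqrt (⟪b 0, z - c + (x - z)⟫ ^ 2 + ⟪b 1, z - c + (x - z)⟫ ^ 2)
        ≤ Real.sqrt (⟪b 0, z - c⟫ ^ 2 + ⟪b 1, z - c⟫ ^ 2) + ‖x - z‖ := radial_add_le b _ _
      _ ≤ σ + D := by
          refine add_le_add ?_ (by rwa [← dist_eq_norm])
          rw [Real.sqrt_le_left hσ]; exact h3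
  refine ⟨?_, ?_, ?_⟩
  · rw [hsplit, inner_add_right]; linarith [hax'.1]
  · rw [hsplit, inner_add_right]; linarith [hax'.2]
  · exact (Real.sqrt_le_left (add_nonneg hσ hD)).1 hrad

/-- ★★ RECORD SHAPE — sites of a Barlow image in a cylinder: window data `(a,h)`, `g` an isometry, `σ ≥ 0`, `α ≤ β`,
`T ⊆ g '' barlowStacking a h s ∩ orthoCylinder b c α β σ` ⟹ `#T · a(a√3/2)h ≤ (β − α + 18/5) · π (σ + 9/5)²`. -/
theorem card_mul_le_cylinder_of_subset_image {a h : ℝ} {s : ℤ → ℤ} {g : E3 → E3}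
    (ha : 9 / 10 ≤ a ∧ a ≤ 11 / 10) (hh : 0 < h ∧ 27 / 50 * a ^ 2 ≤ h ^ 2 ∧ h ^ 2 ≤ 121 / 150 * a ^ 2) (hg : Isometry g)
    (b : OrthonormalBasis (Fin 3) ℝ E3) (c : E3) {α β σ : ℝ} (hσ : 0 ≤ σ) (hαβ : α ≤ β)
    (T : Finset E3) (hT : ↑T ⊆ g '' barlowStacking a h s ∩ orthoCylinder b c α β σ) :
    (T.card : ℝ) * (a * (a * √3 / 2) * h) ≤ (β - α + 18 / 5) * (Real.pi * (σ + 9 / 5) ^ 2) := by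
  have ha0 : 0 ≤ a := by linarith [ha.1]
  have hV0 : 0 ≤ a * (a * √3 / 2) * h := by have := hh.1.le; positivity
  have h1 := card_mul_le_volume_near_of_subset_image ha hh hg _ T hT
  have h2 : volume {x : E3 | ∃ z ∈ orthoCylinder b c α β σ, dist x z ≤ 9 / 5} ≤ volume (orthoCylinder b c (α - 9 / 5) (β + 9 / 5) (σ + 9 / 5)) :=
    measure_mono (near_orthoCylinder_subset b c α β σ (9 / 5) hσ (by norm_num))
  have h3 := h1.trans h2
  have hσ' : 0 ≤ σ + 9 / 5 := by linarith
  rw [volume_orthoCylinder b c hσ', ← ENNReal.ofReal_pow hσ', ← ENNReal.ofReal_mul (pow_nonneg hσ' 2),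
    ← ENNReal.ofReal_mul (by linarith : (0 : ℝ) ≤ β + 9 / 5 - (α - 9 / 5)), ← ENNReal.ofReal_natCast,
    ← ENNReal.ofReal_mul (Nat.cast_nonneg _),
    ENNReal.ofReal_le_ofReal_iff (mul_nonneg (by linarith) (by positivity))] at h3
  have e : (β + 9 / 5 - (α - 9 / 5)) * ((σ + 9 / 5) ^ 2 * Real.pi) = (β - α + 18 / 5) * (Real.pi * (σ + 9 / 5) ^ 2) := by ring
  linarith

end OrthoVolume

end Summit.AtomisticToContinuum.Crystallization.Theorems.ChargedEnergyGapChartDial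

end
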